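import Literature.NumberTheory.GaloisRepresentations.HasseArfCyclicTwistProofs
import HarnessLib

/-!
# The cyclic totally ramified case of Hasse–Arf, III: Serre's Lemma V.13 and Prop. V.11 from its local inputs

Conclusion of the abstract treatment begun in `HasseArfCyclicNormProofs` and
`HasseArfCyclicTwistProofs`: **Serre's Prop. V.11** — for a cyclic totally ramified extension,
`φ(μ)` is an integer at the last lower jump `μ` — is derived, for a discrete valuation ring `S`
with an action of the finite cyclic group `G = ⟨s⟩`, from the inputs its printed proof uses:

* `hf1` — residue degree one: every residue class of `S` contains an `s`-fixed element;
* `he` — total ramification, `e = #G`: `#G ∣ v(z)` for every `s`-fixed `z ≠ 0`;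
* `htr` — an element of non-zero trace (separability);
* `h90` — Hilbert's Theorem 90 in ring form: a norm-one `x` satisfies `s(y) = x y`, `y ≠ 0`;
* `hres` — the residue field is not the prime field (not additively cyclic); Serre reduces to this
  case by an unramified extension of the residue field (Ch. V §4);
* `h10` — Serre's Lemma V.10, i.e. Prop. V.9 / Cor. 1 restricted to norm-one elements: for
  `m ≥ 1` with `φ(m) ∈ ℕ` and `G_m = G_{m+1}`, a norm-one `x ≡ 1 mod 𝔪ᵐ` is `≡ 1 mod 𝔪ᵐ⁺¹`;
* `h12` — Prop. V.8 with Cor. 3 to Prop. V.9, as used in Lemma V.12: for `m ≥ 1`, `n < φ(m)` and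
  `G_{⌈ψ(n+1)⌉} = 1`, every `x ≡ 1 mod 𝔪ᵐ` has the norm of some `y ≡ 1 mod 𝔪^{⌈ψ(n+1)⌉}`.
  (This is the one input that needs completeness of the field.)

Main results:

* `exists_twist_mul_of_norm_eq_one` — the one-step decomposition `V_m = W_m · V_{m+1}` at a level
  where the image of `V_m` fills `U^m/U^{m+1}` (Lemmas V.11–12);
* `exists_natCast_eq_herbrandPhi_of_cyclic` — **Prop. V.11**: if `G_μ ≠ 1 = G_{μ+1}` then
  `φ(μ) ∈ ℕ`.  Proof as printed (pp. 95–96): assuming `φ(μ) ∉ ℕ`, Lemma 13 gives `V_μ ⊆ W`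
  (iterate the decomposition — Lemma 10 at integral `φ(m)`, which forces `m > μ` and
  `G_m = G_{m+1} = 1`; Lemmas 11–12 otherwise, where `n = ⌊φ(m)⌋`, `G_{⌈ψ(n+1)⌉} ⊆ G_{μ+1} = 1` —
  and conclude by Lemma 9 at a level `> v(trace)`); then for `σ = s^{k} ∈ G_μ ∖ 1`,
  `0 < k < #G`, the unit `x = σ(ϖ)/ϖ` lies in `V_μ`, hence `x = s(y)/y`, and
  `z = (∏_{j<k} sʲϖ)/y` is `s`-fixed of valuation `k`, contradicting `#G ∣ v(z)`.  (Serre takes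
  `σ` a generator of `G_μ`; any `σ ≠ 1` in `G_μ` works.)

With the tree's `Ideal.ramificationSubgroup (maximalIdeal S) G` and `herbrandPhi`/`herbrandPsi`.
To discharge the hypothesis `h11` of `hasseArf_of_cyclic` (`HasseArfReductionProofs`) it remains to
(i) pass from the Dedekind setting to the completion (Serre II §3, IV §1 Remark 2) and (ii) prove
`h10`, `h12` there (Serre V §§1–6) and supply `hf1`, `he`, `htr`, `h90`, `hres` (V §4).

## References

* J.-P. Serre, *Local Fields*, GTM 67, Springer 1979, Ch. V §7, Prop. 11 and Lemmas 8–13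
  (pp. 93–96); Ch. V §6, Props. 8–9 and Cor. 1, 3; Ch. V §4. [SerreLocalFields1979]
-/

noncomputable section

open IsLocalRing IsDiscreteValuationRing
open scoped Pointwise

namespace Literature.NumberTheory.GaloisRepresentations

namespace HasseArfCyclic

/-! ### Serre's Lemma V.13 and Prop. V.11 -/

section Prop11

variable {S : Type*} [CommRing S] [IsDomain S] [IsDiscreteValuationRing S]
variable {G : Type*} [Group G] [Fintype G] [MulSemiringAction G S]

omit [Fintype G] in
/-- A uniformiser is moved to an associate: `g ϖ = ϖ c` with `c` a unit. [folklore] -/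
theorem exists_smul_uniformizer_eq_mul (g : G) {ϖ : S} (hϖ : Irreducible ϖ) :
    ∃ c : Sˣ, ϖ * c = g • ϖ := by
  have h : Irreducible (g • ϖ) :=
    (MulEquiv.irreducible_iff (MulSemiringAction.toRingEquiv G S g)).mpr hϖ
  exact associated_of_irreducible S hϖ h

omit [IsDiscreteValuationRing S] in
/-- The unit `c` with `g ϖ = ϖ c` has norm one. [folklore] -/
theorem prod_smul_eq_one_of_mul_eq_smul (g : G) {ϖ : S} (hϖ0 : ϖ ≠ 0) {c : S}
    (hc : ϖ * c = g • ϖ) : ∏ g' : G, g' • c = 1 := by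
  have h := prod_smul_mul (G := G) ϖ c
  rw [hc, prod_smul_smul] at h
  have h0 : ∏ g' : G, g' • ϖ ≠ 0 := by
    rw [Finset.prod_ne_zero_iff]
    intro g' _
    rw [Ne, smul_eq_zero_iff_eq]
    exact hϖ0
  exact (mul_eq_left₀ h0).mp h.symm

/-- **The one-step decomposition `V_m = W_m · V_{m+1}`** (Serre, Lemmas V.11–12): under the
hypotheses of `exists_twist_not_mem_pow_succ`, a norm-one `x ≡ 1 mod 𝔪ᵐ` factors as
`x = x' x''` with `x' = s(u)/u` and `x''` of norm one, `x'' ≡ 1 mod 𝔪ᵐ⁺¹`.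
Ref: Serre, *Local Fields*, Ch. V §7, Lemmas 11–13 (p. 95). [cite: SerreLocalFields1979, Ch. V §7 Lemmas 11–13] -/
theorem exists_twist_mul_of_norm_eq_one (s : G) {ϖ : S} (hϖ : Irreducible ϖ) (c : Sˣ)
    (hc : ϖ * c = s • ϖ)
    (hf1 : ∀ q : S, ∃ a : S, s • a = a ∧ a - q ∈ maximalIdeal S)
    (h90 : ∀ x : S, ∏ g : G, g • x = 1 → ∃ y : S, y ≠ 0 ∧ s • y = x * y)
    (hres : ¬ IsAddCyclic (ResidueField S)) {m : ℕ} (hm : 1 ≤ m)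
    (hV : ∀ x : S, x - 1 ∈ maximalIdeal S ^ m → ∃ v : S, ∏ g : G, g • v = 1 ∧
      v - 1 ∈ maximalIdeal S ^ m ∧ x - v ∈ maximalIdeal S ^ (m + 1))
    {x : S} (hx : x - 1 ∈ maximalIdeal S ^ m) (hN : ∏ g : G, g • x = 1) :
    ∃ x' x'' : S, (∃ u : S, IsUnit u ∧ x' * u = s • u) ∧
      x'' - 1 ∈ maximalIdeal S ^ (m + 1) ∧ ∏ g : G, g • x'' = 1 ∧ x = x' * x'' := by
  obtain ⟨x₁, hW₁, hx₁, hx₁'⟩ := exists_twist_not_mem_pow_succ s hϖ c hc h90 hres hm hV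
  obtain ⟨x', hW', -, hxx'⟩ := exists_twist_sub_mem_pow_succ s hf1 hW₁ hx₁ hx₁' hx
  obtain ⟨X', hX'⟩ := isUnit_of_twist s hW'
  refine ⟨x', x * ↑X'⁻¹, hW', ?_, ?_, ?_⟩
  · have : x * ↑X'⁻¹ - 1 = (x - x') * ↑X'⁻¹ := by
      rw [sub_mul, ← hX', Units.mul_inv]
    rw [this]
    exact Ideal.mul_mem_right _ _ hxx'
  · have h1 : ∏ g : G, g • x' = 1 := prod_smul_eq_one_of_twist s hW'
    have h := prod_smul_mul (G := G) (x * ↑X'⁻¹) x'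
    rw [mul_assoc, ← hX', Units.inv_mul, mul_one, hN, hX', h1, mul_one] at h
    exact h.symm
  · rw [mul_left_comm, ← hX', Units.mul_inv, mul_one]

variable (s : G) (hs : ∀ g : G, g ∈ Subgroup.zpowers s)
include hs

/-- **Serre's Prop. V.11 from its local inputs** (abstract discrete valuation ring `S` with an
action of the finite cyclic group `G = ⟨s⟩`).  Hypotheses: `hf1` (residue degree one: every
residue class has an `s`-fixed representative), `he` (total ramification: `#G ∣ v(z)` for fixed
`z ≠ 0`), `htr` (an element of non-zero trace), `h90` (Hilbert's Theorem 90 in ring form),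
`hres` (the residue field is not the prime field, i.e. not additively cyclic — Serre's reduction by
extension of the residue field, Ch. V §4), `h10` (Serre's Lemma V.10, from Prop. V.9/Cor. 1:
if `φ(m) ∈ ℕ` and `G_m = G_{m+1}` then a norm-one `x ≡ 1 mod 𝔪ᵐ` is `≡ 1 mod 𝔪ᵐ⁺¹`) and `h12`
(Prop. V.8 with Cor. 3 to Prop. V.9, as used in Lemma V.12: if `n < φ(m)` and
`G_{ψ(n+1)} = 1`, every `x ≡ 1 mod 𝔪ᵐ` has the same norm as some `y ≡ 1 mod 𝔪^{ψ(n+1)}`).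
Conclusion: if `G_μ ≠ 1 = G_{μ+1}`, then `φ(μ)` is an integer.  Proof (Serre, pp. 94–96): if not,
Lemma 13 gives `V_μ ⊆ W` (iterate `V_m = W_m V_{m+1}` — Lemma 10 at integral `φ(m)`, Lemmas 11–12
otherwise — and use Lemma 9 for `m ≫ 0`); for `σ = sᵏ ∈ G_μ ∖ 1`, `0 < k < #G`, the unit
`x = σ(ϖ)/ϖ` lies in `V_μ`, so `x = s(y)/y`; then `z = (∏_{j<k} sʲϖ)/y` is `s`-fixed with
`v(z) = k`, contradicting `#G ∣ v(z)`.
Ref: Serre, *Local Fields*, Ch. V §7, Prop. 11 and Lemmas 8–13 (pp. 93–96).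
[cite: SerreLocalFields1979, Ch. V §7 Prop. 11 (proof, pp. 93–96)] -/
theorem exists_natCast_eq_herbrandPhi_of_cyclic
    (hf1 : ∀ q : S, ∃ a : S, s • a = a ∧ a - q ∈ maximalIdeal S)
    (he : ∀ z : S, z ≠ 0 → s • z = z → ∃ q : ℕ, addVal S z = (Nat.card G * q : ℕ))
    (htr : ∃ t : S, ∑ g : G, g • t ≠ 0)
    (h90 : ∀ x : S, ∏ g : G, g • x = 1 → ∃ y : S, y ≠ 0 ∧ s • y = x * y)
    (hres : ¬ IsAddCyclic (ResidueField S))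
    (h10 : ∀ m : ℕ, 1 ≤ m → (∃ n : ℕ, herbrandPhi (maximalIdeal S) G m = n) →
      (maximalIdeal S).ramificationSubgroup G m = (maximalIdeal S).ramificationSubgroup G (m + 1) →
      ∀ x : S, x - 1 ∈ maximalIdeal S ^ m → ∏ g : G, g • x = 1 →
        x - 1 ∈ maximalIdeal S ^ (m + 1))
    (h12 : ∀ n m : ℕ, 1 ≤ m → (n : ℝ) < herbrandPhi (maximalIdeal S) G m →
      (maximalIdeal S).ramificationSubgroup G ⌈herbrandPsi (maximalIdeal S) G (n + 1)⌉₊ = ⊥ →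
      ∀ x : S, x - 1 ∈ maximalIdeal S ^ m → ∃ y : S,
        y - 1 ∈ maximalIdeal S ^ ⌈herbrandPsi (maximalIdeal S) G (n + 1)⌉₊ ∧
        ∏ g : G, g • y = ∏ g : G, g • x)
    {μ : ℕ} (hμ : (maximalIdeal S).ramificationSubgroup G μ ≠ ⊥)
    (hμ1 : (maximalIdeal S).ramificationSubgroup G (μ + 1) = ⊥) :
    ∃ n : ℕ, (n : ℝ) = herbrandPhi (maximalIdeal S) G μ := by
  classical
  by_contra hne
  push Not at hne
  -- notation and basic objects
  obtain ⟨ϖ, hϖ⟩ := exists_irreducible S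
  obtain ⟨c, hc⟩ := exists_smul_uniformizer_eq_mul s hϖ
  have hGbot : ∀ i, μ + 1 ≤ i → (maximalIdeal S).ramificationSubgroup G i = ⊥ := fun i hi =>
    le_bot_iff.mp (hμ1 ▸ (maximalIdeal S).ramificationSubgroup_antitone G hi)
  have hμpos : 1 ≤ μ := by
    rcases Nat.eq_zero_or_pos μ with h | h
    · exact absurd (by rw [h, Nat.cast_zero, herbrandPhi_zero]) (hne 0)
    · exact h
  ------------------------------------------------------------------
  -- Step A: one-step decomposition `V_m = W · V_{m+1}` for every `m ≥ μ`
  ------------------------------------------------------------------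
  have stepA : ∀ m : ℕ, μ ≤ m → ∀ x : S, x - 1 ∈ maximalIdeal S ^ m → ∏ g : G, g • x = 1 →
      ∃ x' x'' : S, (∃ u : S, IsUnit u ∧ x' * u = s • u) ∧
        x'' - 1 ∈ maximalIdeal S ^ (m + 1) ∧ ∏ g : G, g • x'' = 1 ∧ x = x' * x'' := by
    intro m hμm x hx hN
    have hm : 1 ≤ m := hμpos.trans hμm
    by_cases hint : ∃ n : ℕ, herbrandPhi (maximalIdeal S) G m = n
    · -- Lemma 10: `φ(m) ∈ ℕ` forces `m ≥ μ + 1`, where `G_m = G_{m+1} = 1`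
      have hmμ : m ≠ μ := by
        rintro rfl
        obtain ⟨n, hn⟩ := hint
        exact hne n hn.symm
      have hm1 : μ + 1 ≤ m := by omega
      refine ⟨1, x, ⟨1, isUnit_one, by simp⟩, ?_, hN, (one_mul x).symm⟩
      exact h10 m hm hint (by rw [hGbot m hm1, hGbot (m + 1) (by omega)]) x hx hN
    · -- Lemmas 11–12 at a non-integral `φ(m)`: `n < φ(m) < n + 1`, `G_{ψ(n+1)} = 1`
      push Not at hint
      set n : ℕ := ⌊herbrandPhi (maximalIdeal S) G m⌋₊ with hn
      have hφ0 : 0 ≤ herbrandPhi (maximalIdeal S) G m :=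
        (herbrandPhi_nonneg_iff _ G).mpr (Nat.cast_nonneg m)
      have hnle : (n : ℝ) ≤ herbrandPhi (maximalIdeal S) G m := Nat.floor_le hφ0
      have hnlt : (n : ℝ) < herbrandPhi (maximalIdeal S) G m :=
        lt_of_le_of_ne hnle fun h => hint n h.symm
      have hlt1 : herbrandPhi (maximalIdeal S) G m < n + 1 := Nat.lt_floor_add_one _
      set M : ℕ := ⌈herbrandPsi (maximalIdeal S) G (n + 1)⌉₊ with hM
      have hmM : m + 1 ≤ M := by
        have h1 : (m : ℝ) < herbrandPsi (maximalIdeal S) G (n + 1) := by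
          rw [← not_le, herbrandPsi_le_iff]
          exact not_le.mpr hlt1
        exact Nat.lt_ceil.mpr h1
      have hGM : (maximalIdeal S).ramificationSubgroup G M = ⊥ := hGbot M (by omega)
      -- the image of `V_m` in `U^m/U^{m+1}` is everything (from `h12`)
      have hV : ∀ x : S, x - 1 ∈ maximalIdeal S ^ m → ∃ v : S, ∏ g : G, g • v = 1 ∧
          v - 1 ∈ maximalIdeal S ^ m ∧ x - v ∈ maximalIdeal S ^ (m + 1) := by
        intro x hx
        obtain ⟨y, hyM, hyN⟩ := h12 n m hm hnlt hGM x hx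
        have hym1 : y - 1 ∈ maximalIdeal S ^ (m + 1) := Ideal.pow_le_pow_right hmM hyM
        have hym : y - 1 ∈ maximalIdeal S ^ m := Ideal.pow_le_pow_right (by omega) hym1
        obtain ⟨Y, hY⟩ := isUnit_of_sub_one_mem hm hym
        have hxu : IsUnit x := isUnit_of_sub_one_mem hm hx
        refine ⟨x * ↑Y⁻¹, ?_, ?_, ?_⟩
        · have h := prod_smul_mul (G := G) (x * ↑Y⁻¹) (Y : S)
          rw [mul_assoc, Units.inv_mul, mul_one, hY, hyN] at h
          have h0 : ∏ g : G, g • x ≠ 0 := by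
            rw [Finset.prod_ne_zero_iff]
            intro g _
            rw [Ne, smul_eq_zero_iff_eq]
            exact hxu.ne_zero
          exact (mul_eq_right₀ h0).mp h.symm
        · exact mul_units_inv_sub_one_mem hx (hY ▸ hym)
        · have : x - x * ↑Y⁻¹ = x * ↑Y⁻¹ * ((Y : S) - 1) := by
            rw [mul_sub, mul_assoc, Units.inv_mul, mul_one, mul_one]
          rw [this]
          exact Ideal.mul_mem_left _ _ (hY ▸ hym1)
      exact exists_twist_mul_of_norm_eq_one s hϖ c hc hf1 h90 hres hm hV hx hN
  ------------------------------------------------------------------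
  -- Step B (Lemma 13): iterate, `V_μ ⊆ W · V_{μ+k}`
  ------------------------------------------------------------------
  have stepB : ∀ k : ℕ, ∀ x : S, x - 1 ∈ maximalIdeal S ^ μ → ∏ g : G, g • x = 1 →
      ∃ x' x'' : S, (∃ u : S, IsUnit u ∧ x' * u = s • u) ∧
        x'' - 1 ∈ maximalIdeal S ^ (μ + k) ∧ ∏ g : G, g • x'' = 1 ∧ x = x' * x'' := by
    intro k
    induction k with
    | zero =>
      intro x hx hN
      exact ⟨1, x, ⟨1, isUnit_one, by simp⟩, by simpa using hx, hN, (one_mul x).symm⟩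
    | succ k ih =>
      intro x hx hN
      obtain ⟨x', x'', hW', hx'', hN'', rfl⟩ := ih x hx hN
      obtain ⟨y', y'', hWy', hy'', hNy'', rfl⟩ := stepA (μ + k) (by omega) x'' hx'' hN''
      exact ⟨x' * y', y'', twist_mul s hW' hWy', hy'', hNy'', (mul_assoc _ _ _).symm⟩
  ------------------------------------------------------------------
  -- Step C (Lemma 9): `V_μ ⊆ W`
  ------------------------------------------------------------------
  obtain ⟨t, ht⟩ := htr
  have stepC : ∀ x : S, x - 1 ∈ maximalIdeal S ^ μ → ∏ g : G, g • x = 1 →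
      ∃ u : S, IsUnit u ∧ x * u = s • u := by
    intro x hx hN
    set m₀ : ℕ := (addVal S (∑ g : G, g • t)).toNat with hm₀
    have hm₀' : addVal S (∑ g : G, g • t) = m₀ := by
      rw [hm₀, ENat.coe_toNat]
      rwa [Ne, addVal_eq_top_iff]
    obtain ⟨x', x'', hW', hx'', hN'', rfl⟩ := stepB (m₀ + 1) x hx hN
    have hlt : addVal S (∑ g : G, g • t) < ((μ + (m₀ + 1) : ℕ) : ℕ∞) := by
      rw [hm₀']
      exact_mod_cast (by omega : m₀ < μ + (m₀ + 1))
    exact twist_mul s hW' (exists_mul_eq_smul_of_norm_eq_one s hs t ht hlt hx'' hN'')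
  ------------------------------------------------------------------
  -- Step D: `σ = s^k₀ ∈ G_μ ∖ 1`, `x = σ(ϖ)/ϖ ∈ V_μ ⊆ W`, and the valuation count
  ------------------------------------------------------------------
  obtain ⟨⟨σ, hσμ⟩, hσ1⟩ := Subgroup.ne_bot_iff_exists_ne_one.mp hμ
  have hσ1' : σ ≠ 1 := fun h => hσ1 (Subtype.ext h)
  obtain ⟨k₀, hk₀r, hk₀⟩ : ∃ k₀ ∈ Finset.range (orderOf s), s ^ k₀ = σ := by
    simpa only [Finset.mem_image] using (mem_zpowers_iff_mem_range_orderOf.mp (hs σ))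
  rw [Finset.mem_range, orderOf_eq_card_of_forall_mem_zpowers hs] at hk₀r
  have hk₀0 : k₀ ≠ 0 := by
    rintro rfl
    exact hσ1' (by rw [← hk₀, pow_zero])
  -- `σ ϖ = ϖ cσ`, `cσ ∈ V_μ`
  obtain ⟨cσ, hcσ⟩ := exists_smul_uniformizer_eq_mul σ hϖ
  have hNcσ : ∏ g : G, g • (cσ : S) = 1 := prod_smul_eq_one_of_mul_eq_smul σ hϖ.ne_zero hcσ
  have hcσμ : (cσ : S) - 1 ∈ maximalIdeal S ^ μ := by
    have h1 : σ • ϖ - ϖ ∈ maximalIdeal S ^ (μ + 1) := (Ideal.mem_ramificationSubgroup_iff.mp hσμ).2 ϖ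
    rw [← hcσ, show ϖ * ↑cσ - ϖ = ϖ * ((cσ : S) - 1) by ring, hϖ.maximalIdeal_eq,
      Ideal.span_singleton_pow, Ideal.mem_span_singleton, pow_succ'] at h1
    rw [hϖ.maximalIdeal_eq, Ideal.span_singleton_pow, Ideal.mem_span_singleton]
    exact (mul_dvd_mul_iff_left hϖ.ne_zero).mp h1
  obtain ⟨y, hyu, hy⟩ := stepC _ hcσμ hNcσ
  obtain ⟨Y, rfl⟩ := hyu
  -- `Q = ∏_{j<k₀} sʲ ϖ`, `s Q = Q cσ`
  set Q : S := ∏ j ∈ Finset.range k₀, s ^ j • ϖ with hQ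
  have hQ0 : Q ≠ 0 := by
    rw [hQ, Finset.prod_ne_zero_iff]
    intro j _
    rw [Ne, smul_eq_zero_iff_eq]
    exact hϖ.ne_zero
  have hQval : addVal S Q = k₀ := by
    rw [hQ, addVal_prod]
    simp_rw [addVal_smul, addVal_uniformizer hϖ]
    rw [Finset.sum_const, Finset.card_range, nsmul_one]
  have hsQ : s • Q = Q * cσ := by
    have h := mul_smul_prod_range s ϖ k₀
    rw [Finset.prod_range_succ, hk₀, ← hcσ] at h
    -- h : ϖ * s • Q = Q * (ϖ * cσ)
    apply mul_left_cancel₀ hϖ.ne_zero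
    rw [h]
    ring
  -- `z = Q / y` is fixed by `s` and has valuation `k₀`
  set z : S := Q * ↑Y⁻¹ with hz
  have hz0 : z ≠ 0 := mul_ne_zero hQ0 (Units.ne_zero _)
  have hsz : s • z = z := by
    have hne' : s • (Y : S) ≠ 0 := by
      rw [Ne, smul_eq_zero_iff_eq]
      exact Units.ne_zero _
    apply mul_right_cancel₀ hne'
    rw [← smul_mul', hz, mul_assoc, Units.inv_mul, mul_one, hsQ, ← hy]
    rw [show Q * ↑Y⁻¹ * (↑cσ * ↑Y) = Q * ↑cσ * (↑Y⁻¹ * ↑Y) by ring, Units.inv_mul, mul_one]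
  have hzval : addVal S z = k₀ := by
    rw [hz, addVal_mul, hQval, addVal_eq_zero_of_unit, add_zero]
  obtain ⟨q, hq⟩ := he z hz0 hsz
  rw [hzval, Nat.cast_inj] at hq
  exact hk₀0 (Nat.eq_zero_of_dvd_of_lt ⟨q, hq⟩ hk₀r)

end Prop11

end HasseArfCyclic

end Literature.NumberTheory.GaloisRepresentations

end
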